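import Summits.QuantumFields.YangMills.Theorems.DiagonalMirrorRPRWilsonDiagonalModelShiftedBlockSandwich
import Summits.QuantumFields.YangMills.Theorems.DiagonalMirrorRPRWilsonDiagonalModelSpectralPairing
import Literature.Analysis.OperatorTheory.PositiveKernelSpectralTraceTwo

/-!
# Crux `WeakCouplingHypercubicLimitRP` (stmt-QuantumFields-27398) / aside `DiagonalMirrorRPR` (stmt-QuantumFields-10604), door B, R1-side
# supply chain of D1′ (`stub_oddTorusSwapPairingLiminf`), item (ii) step 3: the TWO-INSERTION SPECTRAL FORM
# `Σ_{(i,j)} κⱼ^{s} κᵢ^{n} ⟪bⱼ, 𝒯_f bᵢ⟫ ⟪bⱼ, 𝒯_g bᵢ⟫ = ∫ Θf · g(· + s) · (K_u pair chain)`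

Helper file (`--supports stmt-QuantumFields-27398 --as helper`) of the hand `hand-10604-wilsonDiagModel-2` g3 (docket director-ym g24, O4 WORD 47 (2) /
48 (1): item (ii)); it closes nothing by itself.  The two-insertion cyclic trace formula of the tree is IMPORTED BY NAME
(`Literature/…/PositiveKernelSpectralTraceTwo.hasSum_integral_iterate_insert_two` with `HeterogeneousCyclicPeeling.integral_cyclic_insert_two`,
item (i) of O4 WORD 47 — hand-3's finding that it is already in the tree), not re-derived.

WHAT.  With hand-1's eigen-package of the reweighted lifted kernel `𝔟` on `L²(μ̃)` (`A bᵢ = κᵢ bᵢ`) and, for a bounded measurable observable `f` of depth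
`e + 1`, the **half-block transport operator** `𝒯_f` on `L²(μ̃)` — kernel `halfBlockT f (v, x)` (hand-2, `…OpenLink`), transporting a state at the block
boundary `x` across the `e + 1` layers carrying `f` to the reflection layer `v`:
* §1 `inner_kernelOp_transpose` (generic, finite measure): the operator of the transposed kernel is the adjoint — `⟪ψ, 𝒳ᵀ φ⟫ = ⟪φ, 𝒳 ψ⟫` (Fubini);
* §2 `exists_halfBlockOp` (`𝒯_f` exists as a bounded operator given a.e. by its kernel; tree `exists_kernelOp`);
* §3 ★★ **`hasSum_pow_mul_pow_mul_inner_halfBlockOp`**: for `m = 2e + a + b' + 6` and ANY bounded operators `𝒯_f, 𝒯_g` with kernels `halfBlockT f`,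
  `halfBlockT g`,
  `Σ_{(i,j)} κⱼ^{a+2} κᵢ^{b'+2} ⟪bⱼ, 𝒯_f bᵢ⟫ ⟪bⱼ, 𝒯_g bᵢ⟫ = ∫ Θf(P) · g(P(· + (a+2))) · ∏_t e^{β even_t} e^{β odd_t} dP`
  — `Tr(𝒯_f^† 𝔅^{a+2} 𝒯_g 𝔅^{b'+2})` in the eigenbasis of `𝔅`: the tree's `hasSum_integral_iterate_insert_two` (applied to `Xᵀ_f` and `X_g`) + its
  path-space form `integral_cyclic_insert_two (a+2) (b'+1)` + `…ShiftedBlockSandwich.integral_obsL_mul_obsR_shift_mul_pairChain_eq_insertTwo` + §1;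
  `hasSum_pow_mul_pow_mul_sq_inner_halfBlockOp` — the case `g = f`: the two-index weights are the SQUARES `⟪bⱼ, 𝒯_f bᵢ⟫² ≥ 0` (the visible/off-top
  weights `ω(a,b)` of the two-shift sandwich `…TwoShiftExtraction.sandwich`, up to normalisation).
The gap exponent is the number `a + 2 ≥ 2` of free layers between the mirror and the shifted observable, the far exponent `b' + 2 = m − (a+2) − 2(e+1) ≥ 2`.

HONEST FRAMING: the pairing layer at the operator level for a shifted observable; no letter is proved; D1′, ⟨27398⟩ (0∕2), S6i and the aside
⟨10604⟩ are OPEN; nothing here bears on the summit; the Yang–Mills mass gap is NOT proved here or anywhere in the tree.  No definition, no instance, no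
notation, `autoImplicit false`.

References: K. Osterwalder, E. Seiler, Ann. Phys. 110 (1978) §2–3; B. Simon, *Trace Ideals* (2005) Ch. 3; M. Reed, B. Simon I (1980) §VI.6;
I. Montvay, G. Münster, *Quantum Fields on a Lattice* (1994) §1.5.2 (two-point functions through the transfer matrix).
-/

set_option autoImplicit false

noncomputable section

open scoped BigOperators ENNReal RealInnerProductSpace
open MeasureTheory Function
open Literature.MathematicalPhysics.QuantumLattice Literature.MathematicalPhysics.QuantumFieldTheory
open Summit.QuantumFields.YangMills.Cruxes.DiagonalMirrorRPR.ParityBridgeColdTraces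

namespace Summit.QuantumFields.YangMills.Cruxes.DiagonalMirrorRPR.SignTwistedDiagonalTrace.WilsonDiagonal

/-! ## §1 The operator of the transposed kernel is the adjoint -/

section Transpose

variable {X : Type*} [MeasurableSpace X] {μ : Measure X} [IsFiniteMeasure μ]

/-- **Transposed kernel = adjoint** (finite measure, bounded strongly measurable kernel): if `𝒳` is given a.e. by the kernel `K(x,y)` and `𝒳ᵀ` by
`K(y,x)`, then `⟪ψ, 𝒳ᵀ φ⟫ = ⟪φ, 𝒳 ψ⟫` (two Fubini interchanges, as in the tree's `isSelfAdjoint_kernelOp`). [folklore] -/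
theorem inner_kernelOp_transpose {K : X → X → ℝ} {C : ℝ} (hK : StronglyMeasurable (uncurry K)) (hC : ∀ x y, ‖K x y‖ ≤ C)
    {A AT : Lp ℝ 2 μ →L[ℝ] Lp ℝ 2 μ} (hA : ∀ φ : Lp ℝ 2 μ, (A φ : X → ℝ) =ᵐ[μ] fun x => ∫ y, K x y * φ y ∂μ)
    (hAT : ∀ φ : Lp ℝ 2 μ, (AT φ : X → ℝ) =ᵐ[μ] fun x => ∫ y, K y x * φ y ∂μ) (ψ φ : Lp ℝ 2 μ) :
    ⟪ψ, AT φ⟫ = ⟪φ, A ψ⟫ := by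
  rw [Literature.Analysis.OperatorTheory.inner_kernelOp_eq_integral hAT,
    Literature.Analysis.OperatorTheory.inner_kernelOp_eq_integral hA]
  have h1 : ∫ x, ψ x * ∫ y, K y x * φ y ∂μ ∂μ = ∫ x, ∫ y, ψ x * (K y x * φ y) ∂μ ∂μ := by
    refine integral_congr_ae (ae_of_all _ fun x => ?_)
    exact (integral_const_mul (ψ x) _).symm
  have h2 : ∫ x, φ x * ∫ y, K x y * ψ y ∂μ ∂μ = ∫ x, ∫ y, φ x * (K x y * ψ y) ∂μ ∂μ := by
    refine integral_congr_ae (ae_of_all _ fun x => ?_)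
    exact (integral_const_mul (φ x) _).symm
  have hKT : StronglyMeasurable (uncurry fun x y => K y x) := by
    have h : (uncurry fun x y => K y x) = uncurry K ∘ Prod.swap := by
      funext p; rfl
    rw [h]
    exact hK.comp_measurable measurable_swap
  rw [h1, h2, integral_integral_swap (Literature.Analysis.OperatorTheory.integrable_mul_kernel_mul hKT (fun x y => hC y x) ψ φ)]
  refine integral_congr_ae (ae_of_all _ fun y => ?_)
  refine integral_congr_ae (ae_of_all _ fun x => ?_)
  dsimp only
  ring

end Transpose

/-! ## §2 The half-block transport operator `𝒯_f` -/

section HalfBlockOp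

variable {S : ℕ} [NeZero S] {G : Type} [Group G] {Nc : ℕ} (ρ : G →* Matrix (Fin Nc) (Fin Nc) ℂ)
variable [TopologicalSpace G] [IsTopologicalGroup G] [CompactSpace G] [MeasurableSpace G] [BorelSpace G]
  [SecondCountableTopology G]

/-- **The half-block transport operator `𝒯_f`** on `L²(μ̃)`: a bounded operator with `(𝒯_f φ)(v) = ∫ halfBlockT f (v, x) φ(x) dμ̃(x)` a.e.
(`β ≥ 0`, `|w(Y)_j| ≤ M`, `f` of depth `e + 1` bounded measurable). -/
theorem exists_halfBlockOp (hρ : Continuous ρ) {β : ℝ} (hβ : 0 ≤ β) {M : ℝ}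
    (hM : ∀ (Y : HalfCfg S S G) (j : Fin (featDim S Nc)), |bondVec ρ Y j| ≤ M) {e : ℕ}
    {f : (Fin (e + 1) → HalfCfg S S G) → (Fin (e + 1) → HalfCfg S S G) → ℝ} (hf : Measurable (uncurry f))
    {B : ℝ} (hB : ∀ Y X, |f Y X| ≤ B) :
    ∃ T : Lp ℝ 2 (tMeasure S G Nc β M) →L[ℝ] Lp ℝ 2 (tMeasure S G Nc β M),
      ∀ φ : Lp ℝ 2 (tMeasure S G Nc β M), (T φ : ℕ × HalfCfg S S G → ℝ) =ᵐ[tMeasure S G Nc β M]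
        fun v => ∫ x, halfBlockT S G Nc ρ β M f v x * φ x ∂(tMeasure S G Nc β M) := by
  haveI := isFiniteMeasure_tMeasure (S := S) (G := G) (Nc := Nc) hβ M
  obtain ⟨C, hC0, hC⟩ := exists_abs_openLink_le ρ hρ β hM
  obtain ⟨CT, -, hCT⟩ := exists_abs_halfBlockT_le (S := S) (Nc := Nc) ρ hβ M hC0.le hC hB (e := e)
  have hX : StronglyMeasurable (uncurry (halfBlockT S G Nc ρ β M f)) := (measurable_halfBlockT (S := S) ρ hρ hβ M hf).stronglyMeasurable
  exact Literature.Analysis.OperatorTheory.exists_kernelOp hX (C := CT) (fun v x => by rw [Real.norm_eq_abs]; exact hCT v x)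

/-! ## §3 ★★ The two-insertion trace formula for the shifted reflected pairing -/

/-- ★★ **`Σ_{(i,j)} κⱼ^{a+2} κᵢ^{b'+2} ⟪bⱼ, 𝒯_f bᵢ⟫ ⟪bⱼ, 𝒯_g bᵢ⟫ = ∫ Θf · g(· + (a+2)) · (K_u pair chain of length 2e + a + b' + 6)`**
(`β ≥ 0`, `ρ` continuous unitary, `|w(Y)_j| ≤ M`): for ANY bounded operator `A` on `L²(μ̃)` with kernel `𝔟` and countable Hilbert basis of eigenvectors
`A bᵢ = κᵢ bᵢ`, bounded measurable observables `f, g` of depth `e + 1`, and ANY bounded operators `𝒯_f, 𝒯_g` with kernels `halfBlockT f`, `halfBlockT g`.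
The tree's two-insertion trace formula `hasSum_integral_iterate_insert_two` for `Tr(𝒯_f^† 𝔅^{a+2} 𝒯_g 𝔅^{b'+2})`, in path-space form
(`integral_cyclic_insert_two`), on the layout of `…ShiftedBlockSandwich`; the reversed block of the mirror observable enters through `𝒯_f^†` (§1). -/
theorem hasSum_pow_mul_pow_mul_inner_halfBlockOp (hρ : Continuous ρ) {β : ℝ} (hβ : 0 ≤ β)
    (hρu : ∀ g, ρ g ∈ Matrix.unitaryGroup (Fin Nc) ℂ) {M : ℝ}
    (hM : ∀ (Y : HalfCfg S S G) (j : Fin (featDim S Nc)), |bondVec ρ Y j| ≤ M)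
    {A : Lp ℝ 2 (tMeasure S G Nc β M) →L[ℝ] Lp ℝ 2 (tMeasure S G Nc β M)}
    (hA : ∀ φ : Lp ℝ 2 (tMeasure S G Nc β M), (A φ : ℕ × HalfCfg S S G → ℝ) =ᵐ[tMeasure S G Nc β M]
      fun x => ∫ y, bKernel ρ β M x y * φ y ∂(tMeasure S G Nc β M))
    {ι : Type} [Countable ι] {b : HilbertBasis ι ℝ (Lp ℝ 2 (tMeasure S G Nc β M))} {κ : ι → ℝ}
    (hb : ∀ i, A (b i) = κ i • b i) {e : ℕ}
    {f g : (Fin (e + 1) → HalfCfg S S G) → (Fin (e + 1) → HalfCfg S S G) → ℝ} (hf : Measurable (uncurry f))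
    (hg : Measurable (uncurry g)) {B : ℝ} (hBf : ∀ Y X, |f Y X| ≤ B) (hBg : ∀ Y X, |g Y X| ≤ B)
    {Tf Tg : Lp ℝ 2 (tMeasure S G Nc β M) →L[ℝ] Lp ℝ 2 (tMeasure S G Nc β M)}
    (hTf : ∀ φ : Lp ℝ 2 (tMeasure S G Nc β M), (Tf φ : ℕ × HalfCfg S S G → ℝ) =ᵐ[tMeasure S G Nc β M]
      fun v => ∫ x, halfBlockT S G Nc ρ β M f v x * φ x ∂(tMeasure S G Nc β M))
    (hTg : ∀ φ : Lp ℝ 2 (tMeasure S G Nc β M), (Tg φ : ℕ × HalfCfg S S G → ℝ) =ᵐ[tMeasure S G Nc β M]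
      fun v => ∫ x, halfBlockT S G Nc ρ β M g v x * φ x ∂(tMeasure S G Nc β M))
    (a b' : ℕ) {m : ℕ} [NeZero m] (hm : m = 2 * e + a + b' + 6) :
    HasSum (fun p : ι × ι => κ p.2 ^ (a + 2) * κ p.1 ^ (b' + 2) * (⟪b p.2, Tf (b p.1)⟫ * ⟪b p.2, Tg (b p.1)⟫))
      (∫ P : ZMod m → HalfCfg S S G × HalfCfg S S G,
        obsL f P * obsR g (fun t => P (t + (((a + 2 : ℕ)) : ZMod m))) *
          ∏ t : ZMod m, Real.exp (β * evenActionU ρ (P t).1 (P t).2 (P (t + 1)).1) *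
            Real.exp (β * oddActionU ρ (P t).2 (P (t + 1)).1 (P (t + 1)).2)
        ∂(Measure.pi fun _ : ZMod m => (halfHaar S G).prod (halfHaar S G))) := by
  haveI := isFiniteMeasure_tMeasure (S := S) (G := G) (Nc := Nc) hβ M
  -- the transfer kernel `𝔟`
  have hK := stronglyMeasurable_bKernel (S := S) ρ hρ β M
  obtain ⟨CK, hCK⟩ := exists_abs_bKernel_le ρ hρ β hM
  have hsymm := bKernel_symm (S := S) ρ β M
  -- the two block kernels: `Xᵀ_f(x, y) = halfBlockT f y x` and `X_g = halfBlockT g`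
  obtain ⟨C, hC0, hC⟩ := exists_abs_openLink_le ρ hρ β hM
  obtain ⟨CT, -, hCT⟩ := exists_abs_halfBlockT_le (S := S) (Nc := Nc) ρ hβ M hC0.le hC hBf (e := e)
  obtain ⟨CT', -, hCT'⟩ := exists_abs_halfBlockT_le (S := S) (Nc := Nc) ρ hβ M hC0.le hC hBg (e := e)
  have hXg : StronglyMeasurable (uncurry (halfBlockT S G Nc ρ β M g)) := (measurable_halfBlockT (S := S) ρ hρ hβ M hg).stronglyMeasurable
  have hXf : StronglyMeasurable (uncurry (halfBlockT S G Nc ρ β M f)) := (measurable_halfBlockT (S := S) ρ hρ hβ M hf).stronglyMeasurable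
  have hXfT : StronglyMeasurable (uncurry fun x y : ℕ × HalfCfg S S G => halfBlockT S G Nc ρ β M f y x) := by
    have h : (uncurry fun x y : ℕ × HalfCfg S S G => halfBlockT S G Nc ρ β M f y x) = uncurry (halfBlockT S G Nc ρ β M f) ∘ Prod.swap := by
      funext p; rfl
    rw [h]
    exact hXf.comp_measurable measurable_swap
  have hCXfT : ∀ x y : ℕ × HalfCfg S S G, ‖halfBlockT S G Nc ρ β M f y x‖ ≤ CT := fun x y => by
    rw [Real.norm_eq_abs]; exact hCT y x
  have hCXg : ∀ x y : ℕ × HalfCfg S S G, ‖halfBlockT S G Nc ρ β M g x y‖ ≤ CT' := fun x y => by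
    rw [Real.norm_eq_abs]; exact hCT' x y
  -- the adjoint `𝒯_f^†` as the operator of the transposed kernel
  obtain ⟨TfT, hTfT⟩ := Literature.Analysis.OperatorTheory.exists_kernelOp (μ := tMeasure S G Nc β M) hXfT hCXfT
  -- the tree's two-insertion trace formula, in path-space form, on the layout of `…ShiftedBlockSandwich`
  have h2 := Literature.Analysis.OperatorTheory.hasSum_integral_iterate_insert_two hK hCK hsymm hA hb hXfT hCXfT hTfT hXg hCXg hTg a b'
  -- a common bound for the three kernels
  have hmX : ∀ x y : ℕ × HalfCfg S S G, ‖halfBlockT S G Nc ρ β M f y x‖ ≤ max (max CT CT') CK := fun x y =>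
    (hCXfT x y).trans ((le_max_left _ _).trans (le_max_left _ _))
  have hmX' : ∀ x y : ℕ × HalfCfg S S G, ‖halfBlockT S G Nc ρ β M g x y‖ ≤ max (max CT CT') CK := fun x y =>
    (hCXg x y).trans ((le_max_right _ _).trans (le_max_left _ _))
  have hmK : ∀ x y : ℕ × HalfCfg S S G, ‖bKernel ρ β M x y‖ ≤ max (max CT CT') CK := fun x y => (hCK x y).trans (le_max_right _ _)
  have hc2 := Literature.Analysis.OperatorTheory.integral_cyclic_insert_two (ρ := tMeasure S G Nc β M)
    (X := fun x y : ℕ × HalfCfg S S G => halfBlockT S G Nc ρ β M f y x) (X' := halfBlockT S G Nc ρ β M g) (K := bKernel ρ β M)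
    hXfT.measurable hXg.measurable hK.measurable hmX hmX' hmK (a + 2) (b' + 1)
  rw [← hc2, ← integral_obsL_mul_obsR_shift_mul_pairChain_eq_insertTwo ρ hρ hβ hρu hM hm hf hg hBf hBg] at h2
  -- `⟪bᵢ, 𝒯_f^† bⱼ⟫ = ⟪bⱼ, 𝒯_f bᵢ⟫`
  have hsummand : (fun p : ι × ι => κ p.2 ^ (a + 2) * κ p.1 ^ (b' + 2) * (⟪b p.2, Tf (b p.1)⟫ * ⟪b p.2, Tg (b p.1)⟫)) =
      fun p : ι × ι => κ p.2 ^ (a + 2) * κ p.1 ^ (b' + 2) * ⟪b p.1, TfT (b p.2)⟫ * ⟪b p.2, Tg (b p.1)⟫ := by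
    funext p
    rw [inner_kernelOp_transpose hXf (fun x y => by rw [Real.norm_eq_abs]; exact hCT x y) hTf hTfT (b p.1) (b p.2)]
    ring
  rw [hsummand]
  exact h2

/-- **The case `g = f`: SQUARED two-index weights.**  `Σ_{(i,j)} κⱼ^{a+2} κᵢ^{b'+2} ⟪bⱼ, 𝒯_f bᵢ⟫² = ∫ Θf · f(· + (a+2)) · (K_u pair chain)` — the
two-index weights of the shifted reflected pairing are squares, hence non-negative (reflection positivity at the level of the two-shift sandwich). -/
theorem hasSum_pow_mul_pow_mul_sq_inner_halfBlockOp (hρ : Continuous ρ) {β : ℝ} (hβ : 0 ≤ β)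
    (hρu : ∀ g, ρ g ∈ Matrix.unitaryGroup (Fin Nc) ℂ) {M : ℝ}
    (hM : ∀ (Y : HalfCfg S S G) (j : Fin (featDim S Nc)), |bondVec ρ Y j| ≤ M)
    {A : Lp ℝ 2 (tMeasure S G Nc β M) →L[ℝ] Lp ℝ 2 (tMeasure S G Nc β M)}
    (hA : ∀ φ : Lp ℝ 2 (tMeasure S G Nc β M), (A φ : ℕ × HalfCfg S S G → ℝ) =ᵐ[tMeasure S G Nc β M]
      fun x => ∫ y, bKernel ρ β M x y * φ y ∂(tMeasure S G Nc β M))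
    {ι : Type} [Countable ι] {b : HilbertBasis ι ℝ (Lp ℝ 2 (tMeasure S G Nc β M))} {κ : ι → ℝ}
    (hb : ∀ i, A (b i) = κ i • b i) {e : ℕ}
    {f : (Fin (e + 1) → HalfCfg S S G) → (Fin (e + 1) → HalfCfg S S G) → ℝ} (hf : Measurable (uncurry f))
    {B : ℝ} (hBf : ∀ Y X, |f Y X| ≤ B)
    {Tf : Lp ℝ 2 (tMeasure S G Nc β M) →L[ℝ] Lp ℝ 2 (tMeasure S G Nc β M)}
    (hTf : ∀ φ : Lp ℝ 2 (tMeasure S G Nc β M), (Tf φ : ℕ × HalfCfg S S G → ℝ) =ᵐ[tMeasure S G Nc β M]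
      fun v => ∫ x, halfBlockT S G Nc ρ β M f v x * φ x ∂(tMeasure S G Nc β M))
    (a b' : ℕ) {m : ℕ} [NeZero m] (hm : m = 2 * e + a + b' + 6) :
    HasSum (fun p : ι × ι => κ p.2 ^ (a + 2) * κ p.1 ^ (b' + 2) * ⟪b p.2, Tf (b p.1)⟫ ^ 2)
      (∫ P : ZMod m → HalfCfg S S G × HalfCfg S S G,
        obsL f P * obsR f (fun t => P (t + (((a + 2 : ℕ)) : ZMod m))) *
          ∏ t : ZMod m, Real.exp (β * evenActionU ρ (P t).1 (P t).2 (P (t + 1)).1) *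
            Real.exp (β * oddActionU ρ (P t).2 (P (t + 1)).1 (P (t + 1)).2)
        ∂(Measure.pi fun _ : ZMod m => (halfHaar S G).prod (halfHaar S G))) := by
  have h := hasSum_pow_mul_pow_mul_inner_halfBlockOp ρ hρ hβ hρu hM hA hb hf hf hBf hBf hTf hTf a b' hm
  simpa only [sq] using h

end HalfBlockOp

end Summit.QuantumFields.YangMills.Cruxes.DiagonalMirrorRPR.SignTwistedDiagonalTrace.WilsonDiagonal

end
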